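import Summits.QuantumFields.BalabanUV.T4Continuum.Spine.NE1p.DressedStabilityOfRatioSchedules
import Summits.QuantumFields.BalabanUV.T4Continuum.Spine.NE1p.DressedPositionalCount
import Summits.QuantumFields.BalabanUV.T4Continuum.Spine.NE1p.DressedAbsorptionWindow
import Summits.QuantumFields.BalabanUV.T4Continuum.Spine.NE1p.DressedAttainment

/-!
# T⁴ programme, spine estimate NE1′ (node O3b/H2) — END-ALL ∘ SUPPLIERS (ratio face): THE ROW ROOT `DressedStability 𝒯` AT EVERY
# CUTOFF AND RUN PARAMETER WITH THE THREE STRUCTURAL BOOKING LEAVES L-B, L-C, F-8 COMPOSED IN — displayed = the wall + DATA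
# (swarm row «S3i» of `t4/formal/NE1p/LEAVES.md`, INTENT HOME/CLAIMS.log l.10308, 2026-08-20T09:44Z)

Cell `pub-balaban`, sub-cell `t4`, BINDER-OWNERS row NE1′ (owner lineage t4-ne1p-p1; root `Spine/NE1p/DressedRoot.lean` p211416,
budget face `Spine/NE1p/DressedRootFam.lean` p211697); swarm unit `b2b-balaban-t4-ne1p-formalise-leaf-02` (gen 2); tree target
`Summits/QuantumFields/BalabanUV/T4Continuum/Spine/NE1p/`; ADDITIVE — imports the crew's landed `Spine/NE1p/DressedStabilityOfRatioSchedules`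
(row S3e END-ALL, p213706), `Spine/NE1p/DressedPositionalCount` (row S4 leaf L-C, p212703), `Spine/NE1p/DressedAbsorptionWindow`
(row S5b ∘ S5 leaf L-B, p212827 ∘ p212423) and `Spine/NE1p/DressedAttainment` (row S8 leaf F-8, p212678) ONLY; modifies nothing.

WHAT THIS FILE DOES.  Row S3e's END-ALL `dressedStability_of_ratioSchedules : DressedStability 𝒯` displays, per `(a, K)`, besides the
WALL binders and the H2 dictionary, FOUR binder families whose suppliers the crew has landed as separate leaves: F-8 `hlin`
(attainment), (w3-book) L-C `hS`∕`hcount` (live families born ∕ positionally counted), (w1)+(w5b) L-B `hbirth` (history-sourced births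
in the uniform class).  This file is the composition and nothing else — END-ALL BY NAME with those four families DISCHARGED BY NAME:
* F-8 `hlin` ⟸ the BOOKING CONVENTION: `hne` (under the dressed history an admissible pair of defect `defect b k′ k` exists in the
  window `bondBall d (ρw k)`) and `hsup` (the booked size `lin b k′ k` is at most the supremum of the realised increments) —
  `DressedAttainment.hlin_budgetGate_of_lin_le_sSup` (row S8).
* L-C `hS`∕`hcount` ⟸ ANCHORING DATA: a block-lattice anchoring `Anch a K : Anchoring (𝒯.B a K) 4 Lb` of every booking with the
  cell's blocking integer `(Lb : ℝ) = L`, per-block multiplicity `mB`, housing of the live families in the met component's cubes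
  (`comp`, `hscale`, `hhoused`) of volume `≤ v`, and `v·mB ≤ N₀` — `DressedPositionalCount.count_of_anchoring` ∕
  `birthScale_le_of_housed` (row S4); `v`, `mB` are bound ONCE, before `∀ a K` (caveat k1 ∕ R4: the collared-component volume is THE
  one K-free instantiation demand of L-C).
* L-B `hbirth` ⟸ ABSORPTION DATA in the live-family door: absorbed families `Sabs a K b` strictly older than `b` and among the live
  families of its met component at its birth scale, absorption under the dressed gate `AbsorbsFrom (4c_δ∕r) ρ (β a K) A (Sabs a K)
  (budgetGate …)` («budgets add»), dressing sizes `β a K j ≤ β₀·(L⁻³)^{K−j}`, and the two located numbers `fanout A N₀ ρ′ < 1`,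
  `absorbAmplitude β₀ A N₀ ρ′ ≤ A₀` — `DressedAbsorptionWindow.hbirth_of_absorbsFrom_live_cell` (rows S5b ∘ S5); `A`, `β₀` bound
  ONCE before `∀ a K`; the history-free (w1) door is the instance `Sabs ≡ ∅`, `A = 0` (`DressedBirthSuppliers.absorbsFrom_of_birthGen`).
* §1 `count_of_anchoring_cell` ∕ `positionalCount_of_anchoring_cell` — row S4's counts in the cell's currency `N₀·(L⁴)^{k−j}`.
* §2 the binders once (S3e's list VERBATIM minus `hlin`∕`hS`∕`hcount`∕`hbirth`, plus the data above); §3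
  **`dressedStability_of_suppliedSchedules : DressedStability 𝒯`** and `dressedStabilityWith_of_suppliedSchedules` (constants
  displayed: `(A₀, rhoOne L⁻² (4c_δ∕r) c̄ κ, L⁻³)`); §4 ROOT-B `dressedBudget_of_suppliedSchedules : DressedBudget 𝒯 wt` with the
  bookings' positional counts ALSO read off the anchoring (`positionalCount_of_anchoring`, given `1 ≤ v`).
EFFECT.  After this face every leaf of `t4/formal/NE1p/DAG.md` §2 classed STRUCTURAL ∕ ARITH ∕ GEOM (L-T-reduced, L-B, L-C, L-F, L-S,
F-4, F-5, F-7, F-8) is discharged inside ONE tower-level theorem; what it displays is exactly the WALL ∕ Q leaves — (w1) `hsl`,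
(w2-act) `hB`∕`hE`∕`hs₀` (THE NUMBER), (w5) `hreg` + `0 ≤ creg ≤ c̄`, (I4′) `hlink`∕`hrate`∕`hdefw`∕`hδfw`∕`hpairx` (F-6's rate
`ψ = L⁻²`, k3), the F-2 dictionary `hFn`∕`h𝒢`∕`hQ`∕`hSg`∕`hs1`∕`hAsz_*`∕`hmeas`, F-9 context `hinv`∕`hDμ`∕`hz₁` — plus instantiation
DATA (ratio-bounded schedules, anchoring, absorption, booking convention) and row S3's located scalars.

HONEST FRAMING.  A COMPOSITION FACE: 0 estimates, 0 new hypothesis shapes, NO `def … : Prop`, every wall binder displayed verbatim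
as row S3e displays it.  Headline (c4): «NE1′ (all cutoffs, all run parameters) ⇐ EXACTLY the displayed WALL binders ∀ (a,K) +
anchoring ∕ absorption ∕ booking-convention DATA + the located largeness∕window + ratio-bounded schedules» — NOT «NE1′ proved»: the
walls are asserted for Bałaban's densities NOWHERE; the schedules' window budget `ρw K + K·w ≤ ρw 0` (LF-1's window half, as in
S3e) sits inside `hsl`'s window, and the uniform slice window `w` of `hpairx` (LF-2, F-ne1pleaf04-1) is displayed as recorded —
their cure is the slice-window END-ALL (row S3h), over which the same composition applies verbatim.  0 binders instantiated on
Bałaban's densities; spine PROVED 0∕9.  Rung (B)+1 on ONE finite four-torus — NOT infinite volume, NOT a mass gap, NOT OS on ℝ⁴,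
NOT the Clay problem, NOT summit progress.  [folklore] kernel glue, 0 sorry, 0 citations.  HONEST DEPENDENCY: continuum YM on T⁴ ⇐
BetaPertH ∧ nine spine estimates (0/9 proved); BetaPertH ⇐ (D1) ∧ (D4) ∧ CAP+tail; G-an2-4 gates asym, D1 and NE2/3/4.
-/

noncomputable section

namespace Summit.QuantumFields.BalabanUV.T4Continuum.NE1p.DressedStabilityOfSuppliedSchedules

open MeasureTheory Set Metric Finset
open scoped BigOperators
open Literature.MathematicalPhysics.QuantumFieldTheory.Balaban1983to89
open Literature.MathematicalPhysics.QuantumFieldTheory.Balaban1983to89.T4TermFormat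
open Literature.MathematicalPhysics.QuantumFieldTheory.Balaban1983to89.T4FeltGeometry
open Literature.MathematicalPhysics.QuantumFieldTheory.Balaban1983to89.T4GatedBooking
open Literature.MathematicalPhysics.QuantumFieldTheory.Balaban1983to89.T4TrajectoryComparison
open Literature.MathematicalPhysics.QuantumFieldTheory.Balaban1983to89.T4TrajectoryModulus
open T4BirthChartTransport (GaugeInvariant BirthSlice RelGauge)
open T4BlockTransport (Fld NDir latMove latN)
open T4TrajectoryDensity
open Summit.QuantumFields.BalabanUV.T4Continuum.T4TrajectoryDensityDressed
open Summit.QuantumFields.BalabanUV.T4Continuum.NE1p.DressedRoot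
open Summit.QuantumFields.BalabanUV.T4Continuum.NE1p.DressedWindowSchedule
open Summit.QuantumFields.BalabanUV.T4Continuum.NE1p.DressedUniformConstants
open Summit.QuantumFields.BalabanUV.T4Continuum.NE1p.DressedTransportRatioScheduled
open Summit.QuantumFields.BalabanUV.T4Continuum.NE1p.DressedStabilityOfRatioSchedules
open Summit.QuantumFields.BalabanUV.T4Continuum.NE1p.DressedPositionalCount
open Summit.QuantumFields.BalabanUV.T4Continuum.NE1p.DressedAbsorptionWindow
open Summit.QuantumFields.BalabanUV.T4Continuum.NE1p.DressedAttainment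

/-! ## §1 Row S4's anchored counts in the cell's currency `N₀·(L⁴)^{k−j}` -/

section Counts

variable {Bk : T4TermFormat.Booking} {Lb : ℕ} {L N₀ : ℝ} (Anch : Anchoring Bk 4 Lb)

/-- **L-C IN THE CELL'S CURRENCY** [bookkeeping]: an anchoring on the block lattice `ℕ⁴` with the cell's blocking integer
(`(Lb : ℝ) = L`, `1 ≤ L`), per-block multiplicity `mB`, live families housed in the met component's cubes (all of the current
scale) of volume `≤ v`, and `v·mB ≤ N₀` give BOTH (w3-book) fields of `BookingLeaves` at the cell's constants: live families are
born (`hS`) and positionally counted by `N₀·(L⁴)^{k−j}` (`hcount`) — `birthScale_le_of_housed` ∕ `count_of_anchoring` BY NAME.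
[folklore] -/
theorem count_of_anchoring_cell (hLb : (Lb : ℝ) = L) (hL : 1 ≤ L) {mB v : ℕ}
    (hmult : ∀ j (x : Fin 4 → ℕ), (Bk.births.filter fun b => Bk.birthScale b = j ∧ x ∈ Anch.dom b).card ≤ mB)
    {comp : ℕ → Bk.Birth → Finset Bk.Cube} {S : ℕ → Bk.Birth → Finset Bk.Birth}
    (hscale : ∀ k b, ∀ q ∈ comp k b, Bk.cubeScale q = k)
    (hhoused : ∀ k b, ∀ f ∈ S k b, ∃ q ∈ comp k b, f ∈ Bk.feltAt q)
    (hvol : ∀ k b, (comp k b).card ≤ v) (hvN₀ : (v : ℝ) * mB ≤ N₀) :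
    (∀ k b, ∀ f ∈ S k b, Bk.birthScale f ≤ k) ∧
      ∀ k b, ∀ j ≤ k, (((S k b).filter fun f => Bk.birthScale f = j).card : ℝ) ≤ N₀ * (L ^ 4) ^ (k - j) := by
  have hLb0 : 0 < Lb := by
    have h : (0 : ℝ) < (Lb : ℝ) := by rw [hLb]; linarith
    exact_mod_cast h
  refine ⟨birthScale_le_of_housed hscale hhoused, fun k b j hj => ?_⟩
  refine (count_of_anchoring Anch hLb0 hmult hscale hhoused hvol k b j hj).trans ?_
  rw [hLb]
  exact mul_le_mul_of_nonneg_right hvN₀ (by positivity)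

/-- **THE BOOKINGS' POSITIONAL COUNT IN THE CELL'S CURRENCY** [bookkeeping] (ROOT-B's `hcountB`): the same anchoring with
`mB ≤ N₀` gives `PositionalCount (N₀·(L⁴)^{k−j})` — `Anchoring.positionalCount_of_anchoring` ∕ `positionalCount_mono` BY NAME.
[folklore] -/
theorem positionalCount_of_anchoring_cell (hLb : (Lb : ℝ) = L) (hL : 1 ≤ L) {mB : ℕ}
    (hmult : ∀ j (x : Fin 4 → ℕ), (Bk.births.filter fun b => Bk.birthScale b = j ∧ x ∈ Anch.dom b).card ≤ mB)
    (hmN₀ : (mB : ℝ) ≤ N₀) :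
    Bk.PositionalCount fun j k => N₀ * (L ^ 4) ^ (k - j) := by
  have hLb0 : 0 < Lb := by
    have h : (0 : ℝ) < (Lb : ℝ) := by rw [hLb]; linarith
    exact_mod_cast h
  refine positionalCount_mono (Anch.positionalCount_of_anchoring hLb0 hmult) fun j k => ?_
  rw [hLb]
  exact mul_le_mul_of_nonneg_right hmN₀ (by positivity)

end Counts

/-! ## §2 The binders, once, indexed by run parameter and cutoff — S3e's list with `hlin`, `hS`, `hcount`, `hbirth` replaced by data -/

section EndAll

variable {P : Type*} (𝒯 : DressedTower P)
variable {R : Type*} [NormedRing R] [NormedAlgebra ℂ R] [MeasurableSpace R] {d : ℕ}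
variable {r w κ L cbar N₀ A₀ sbar ρ' cδ m : ℝ}
variable (W : ∀ (a : P) (K : ℕ), WindowSchedule r w) (hκ : 0 ≤ κ)
variable {Fn : ∀ (a : P) (K : ℕ), (𝒯.B a K).Birth → ℕ → ℕ → Fld d R → ℂ}
  {rel : ∀ (a : P) (K : ℕ), (𝒯.B a K).Birth → ℕ → ℕ → Fld d R → Fld d R → Prop}
  {ref : ∀ (a : P) (K : ℕ), (𝒯.B a K).Birth → ℕ → Fld d R → Fld d R}
  {base : ∀ (a : P) (K : ℕ), (𝒯.B a K).Birth → ℕ → Fld d R → ℝ}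
  {𝒜 𝒬 : ∀ (a : P) (K : ℕ), (𝒯.B a K).Birth → ℕ → Fld d R → Fld d R → ℂ}
  {q : ∀ (a : P) (K : ℕ), (𝒯.B a K).Birth → ℕ → Fld d R → ℂ}
  {μ : ∀ (a : P) (K : ℕ), (𝒯.B a K).Birth → ℕ → Measure (Fld d R)}
  {z₀ z₁ : ∀ (a : P) (K : ℕ), (𝒯.B a K).Birth → ℕ → Fld d R}
  {defect : ∀ (a : P) (K : ℕ), (𝒯.B a K).Birth → ℕ → ℕ → ℝ}
  {s s1 : ∀ (a : P) (K : ℕ), (𝒯.B a K).Birth → ℕ → ℝ}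
  {Asz : ∀ (a : P) (K : ℕ), (𝒯.B a K).Birth → ℕ → ℕ → ℝ}
  {S : ∀ (a : P) (K : ℕ), ℕ → (𝒯.B a K).Birth → Finset (𝒯.B a K).Birth}
  {Sg : ∀ (a : P) (K : ℕ), ℕ → (𝒯.B a K).Birth → Finset ((𝒯.B a K).Birth × ℕ)}
  {c : ∀ (a : P) (K : ℕ), (𝒯.B a K).Birth → ℕ → ℂ}
  {δf : ∀ (a : P) (K : ℕ), (𝒯.B a K).Birth → ℕ → (𝒯.B a K).Birth × ℕ → ℝ}
  {creg : ∀ (_ : P) (_ : ℕ), ℕ → ℝ}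
-- NEW DATA (this file): anchoring (L-C), absorption (L-B)
variable {Lb mB v : ℕ} (Anch : ∀ (a : P) (K : ℕ), Anchoring (𝒯.B a K) 4 Lb)
  {comp : ∀ (a : P) (K : ℕ), ℕ → (𝒯.B a K).Birth → Finset (𝒯.B a K).Cube}
  {Sabs : ∀ (a : P) (K : ℕ), (𝒯.B a K).Birth → Finset (𝒯.B a K).Birth}
  {β : ∀ (_ : P) (_ : ℕ), ℕ → ℝ} {A β₀ : ℝ}

variable (hratio : ∀ (a : P) (K : ℕ), ∀ k, 2 * (W a K).σ k ≤ κ * (W a K).ϱc k)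
-- row S3's located scalars ((w7) largeness, (w6) window) and signs
variable (hL : 1 ≤ L)
variable (hcbar : 0 ≤ cbar)
variable (hN₀ : 0 ≤ N₀)
variable (hA₀ : 0 ≤ A₀)
variable (hm : 0 ≤ m)
variable (hloc : locCell L (4 * cδ / r) cbar κ ≤ ρ')
variable (hρ'1 : ρ' < 1)
variable (hsmall : m * (N₀ * A₀ * (1 - ρ')⁻¹) ≤ 1 - sbar)
-- scalars of the ratio-END
variable (hr : 0 < r)
variable (hcδ : 0 ≤ cδ)
-- the ratio-END's wall ∕ dictionary binders at ψ := L⁻²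
variable (hsl : ∀ (a : P) (K : ℕ), ∀ (b : (𝒯.B a K).Birth) (k' : ℕ), (𝒯.B a K).birthScale b ≤ k' → k' ≤ (𝒯.B a K).K →
  RanBelow (budgetGate (𝒯.T a K) (s a K) m (S a K) (4 * cδ / r) (fun i => (L ^ 2)⁻¹ * (fun _ : ℕ => alphaCell κ) i)) k' →
  BirthSlice ((Fn a K) b k' k') latMove latN (bondBall d ((W a K).ρw k') : Set (Fld d R)) w r ((𝒯.T a K).gen b k'))
variable (hFn : ∀ (a : P) (K : ℕ), ∀ (b : (𝒯.B a K).Birth) (k' k : ℕ), (𝒯.B a K).birthScale b ≤ k' → k' ≤ k → k + 1 ≤ (𝒯.B a K).K →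
  RanBelow (budgetGate (𝒯.T a K) (s a K) m (S a K) (4 * cδ / r) (fun i => (L ^ 2)⁻¹ * (fun _ : ℕ => alphaCell κ) i)) (k + 1) →
  ∀ U, (Fn a K) b k' (k + 1) U =
  wOp (expWeight ((base a K) b k) ((𝒜 a K) b k + (𝒬 a K) b k)) ((μ a K) b k) ((z₀ a K) b k) U (fun z => (Fn a K) b k' k (U + z)))
variable (h𝒢 : ∀ (a : P) (K : ℕ), ∀ (b : (𝒯.B a K).Birth) (k' k : ℕ), (𝒯.B a K).birthScale b ≤ k' → k' ≤ k → k + 1 ≤ (𝒯.B a K).K →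
  RanBelow (budgetGate (𝒯.T a K) (s a K) m (S a K) (4 * cδ / r) (fun i => (L ^ 2)⁻¹ * (fun _ : ℕ => alphaCell κ) i)) (k + 1) →
  ∀ U, (fun z => (Fn a K) b k' k (U + z)) ∈ BddClass ℂ ((μ a K) b k))
variable (hB : ∀ (a : P) (K : ℕ), ∀ (b : (𝒯.B a K).Birth) (k' k : ℕ), (𝒯.B a K).birthScale b ≤ k' → k' ≤ k → k + 1 ≤ (𝒯.B a K).K →
  RanBelow (budgetGate (𝒯.T a K) (s a K) m (S a K) (4 * cδ / r) (fun i => (L ^ 2)⁻¹ * (fun _ : ℕ => alphaCell κ) i)) (k + 1) →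
  RealBaseAt ((ref a K) b k) ((base a K) b k) ((𝒜 a K) b k) ((μ a K) b k) (bondBall d ((W a K).ρw (k + 1)) : Set (Fld d R)))
variable (hE : ∀ (a : P) (K : ℕ), ∀ (b : (𝒯.B a K).Birth) (k' k : ℕ), (𝒯.B a K).birthScale b ≤ k' → k' ≤ k → k + 1 ≤ (𝒯.B a K).K →
  RanBelow (budgetGate (𝒯.T a K) (s a K) m (S a K) (4 * cδ / r) (fun i => (L ^ 2)⁻¹ * (fun _ : ℕ => alphaCell κ) i)) (k + 1) →
  ExponentSliceAt ((ref a K) b k) ((𝒜 a K) b k) ((μ a K) b k) latMove latN (bondBall d ((W a K).ρw (k + 1)) : Set (Fld d R)) w ((W a K).ϱc k)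
  ((s a K) b k))
variable (hQ : ∀ (a : P) (K : ℕ), ∀ b k, (fun U z => (𝒬 a K) b k U z - (q a K) b k U) =
  fun U z => (c a K) b k * ∑ p ∈ (Sg a K) k b, ((Fn a K) p.1 p.2 k (U + z) - (Fn a K) p.1 p.2 k (U + (z₁ a K) b k)))
variable (hSg : ∀ (a : P) (K : ℕ), ∀ k b, ∀ p ∈ (Sg a K) k b, p.1 ∈ (S a K) k b ∧ (𝒯.B a K).birthScale p.1 ≤ p.2 ∧ p.2 ≤ k)
variable (hs1 : ∀ (a : P) (K : ℕ), ∀ b k, (s1 a K) b k = ‖(c a K) b k‖ * ∑ p ∈ (Sg a K) k b, 4 * (Asz a K) p.1 p.2 k / (W a K).sliceR p.2 k * (δf a K) b k p)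
variable (hAsz_birth : ∀ (a : P) (K : ℕ), ∀ f k'', (Asz a K) f k'' k'' = (𝒯.T a K).gen f k'')
variable (hAsz_step : ∀ (a : P) (K : ℕ), ∀ f k'' k, (𝒯.B a K).birthScale f ≤ k'' → k'' ≤ k →
  (Asz a K) f k'' (k + 1) = Real.exp (3 * ((s a K) f k + (s1 a K) f k)) * (Asz a K) f k'' k)
variable (hlink : ∀ (a : P) (K : ℕ), ∀ b k, ∀ p ∈ (Sg a K) k b,
  0 ≤ (δf a K) b k p ∧ ‖(c a K) b k‖ * ((δf a K) b k p / (W a K).sliceR p.2 k) ≤ m * (cδ / r) * ((L ^ 2)⁻¹) ^ (k - p.2))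
variable (hδfw : ∀ (a : P) (K : ℕ), ∀ b k, ∀ p ∈ (Sg a K) k b, (δf a K) b k p ≤ w)
variable (hDμ : ∀ (a : P) (K : ℕ), ∀ b k, ∀ᵐ z ∂(μ a K) b k, z ∈ (bondBall d ((W a K).σ k) : Set (Fld d R)))
variable (hz₁ : ∀ (a : P) (K : ℕ), ∀ b k, (z₁ a K) b k ∈ (bondBall d ((W a K).σ k) : Set (Fld d R)))
variable (hpairx : ∀ (a : P) (K : ℕ), ∀ (b : (𝒯.B a K).Birth) (k' k : ℕ), (𝒯.B a K).birthScale b ≤ k' → k' ≤ k →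
  ∀ p ∈ (Sg a K) k b, ∀ U₀ ∈ (bondBall d ((W a K).ρw (k + 1)) : Set (Fld d R)), ∀ pd : NDir d R, 0 < latN pd → latN pd ≤ w →
  ∀ᵐ z ∂(μ a K) b k, ∀ t ∈ tube ((W a K).ϱ₁ k / latN pd),
  RelGauge ((rel a K) p.1 p.2 k) latMove latN (latMove U₀ pd t + (z₁ a K) b k) (latMove U₀ pd t + z) ((δf a K) b k p))
variable (hinv : ∀ (a : P) (K : ℕ), ∀ b k' k, GaugeInvariant ((rel a K) b k' k) ((Fn a K) b k' k))
variable (hmeas : ∀ (a : P) (K : ℕ), ∀ (b f : (𝒯.B a K).Birth) (k'' k : ℕ) (U : Fld d R), AEStronglyMeasurable (fun z => (Fn a K) f k'' k (U + z)) ((μ a K) b k))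
variable (hdefw : ∀ (a : P) (K : ℕ), ∀ b k' k, (defect a K) b k' k ≤ w)
variable (hrate : ∀ (a : P) (K : ℕ), ∀ (b : (𝒯.B a K).Birth) (k' k : ℕ), (𝒯.B a K).birthScale b ≤ k' → k' ≤ k → k ≤ (𝒯.B a K).K →
  (defect a K) b k' k ≤ cδ * ((L ^ 2)⁻¹) ^ (k - k'))
-- F-8 REPLACED BY THE BOOKING CONVENTION (row S8): admissible pairs exist, booked size ≤ sup of realised increments
variable (hne : ∀ (a : P) (K : ℕ), ∀ (b : (𝒯.B a K).Birth) (k' k : ℕ), (𝒯.B a K).birthScale b ≤ k' → k' ≤ k → k ≤ (𝒯.B a K).K →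
  RanBelow (budgetGate (𝒯.T a K) (s a K) m (S a K) (4 * cδ / r) (fun i => (L ^ 2)⁻¹ * (fun _ : ℕ => alphaCell κ) i)) k →
  ∃ U₀ ∈ (bondBall d ((W a K).ρw k) : Set (Fld d R)), ∃ U₁ : Fld d R,
  RelGauge ((rel a K) b k' k) latMove latN U₀ U₁ ((defect a K) b k' k))
variable (hsup : ∀ (a : P) (K : ℕ), ∀ (b : (𝒯.B a K).Birth) (k' k : ℕ), (𝒯.B a K).birthScale b ≤ k' → k' ≤ k → k ≤ (𝒯.B a K).K →
  RanBelow (budgetGate (𝒯.T a K) (s a K) m (S a K) (4 * cδ / r) (fun i => (L ^ 2)⁻¹ * (fun _ : ℕ => alphaCell κ) i)) k →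
  (𝒯.T a K).lin b k' k ≤ sSup {x : ℝ | ∃ U₀ ∈ (bondBall d ((W a K).ρw k) : Set (Fld d R)), ∃ U₁ : Fld d R,
    RelGauge ((rel a K) b k' k) latMove latN U₀ U₁ ((defect a K) b k' k) ∧ x = ‖(Fn a K) b k' k U₁ - (Fn a K) b k' k U₀‖})
-- the booking-level wall binders: (w5) regeneration, (w2-act) margin
variable (hc0 : ∀ (a : P) (K : ℕ), ∀ k, 0 ≤ (creg a K) k)
variable (hcb : ∀ (a : P) (K : ℕ), ∀ k, k < (𝒯.B a K).K → (creg a K) k ≤ cbar)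
variable (hreg : ∀ (a : P) (K : ℕ), (𝒯.T a K).RegeneratesFromVar (creg a K)
  (budgetGate (𝒯.T a K) (s a K) m (S a K) (4 * cδ / r) (fun _ : ℕ => (L ^ 2)⁻¹ * alphaCell κ)))
variable (hs₀ : ∀ (a : P) (K : ℕ), ∀ b k, (s a K) b k ≤ sbar)
-- (w3-book) L-C REPLACED BY ANCHORING DATA (row S4): blocking integer, multiplicity, housing, component volume
variable (hLb : (Lb : ℝ) = L)
variable (hmult : ∀ (a : P) (K : ℕ), ∀ j (x : Fin 4 → ℕ),
  ((𝒯.B a K).births.filter fun b => (𝒯.B a K).birthScale b = j ∧ x ∈ (Anch a K).dom b).card ≤ mB)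
variable (hscale : ∀ (a : P) (K : ℕ), ∀ k b, ∀ q ∈ (comp a K) k b, (𝒯.B a K).cubeScale q = k)
variable (hhoused : ∀ (a : P) (K : ℕ), ∀ k b, ∀ f ∈ (S a K) k b, ∃ q ∈ (comp a K) k b, f ∈ (𝒯.B a K).feltAt q)
variable (hvol : ∀ (a : P) (K : ℕ), ∀ k b, ((comp a K) k b).card ≤ v)
-- (w1)+(w5b) L-B REPLACED BY ABSORPTION DATA (rows S5 ∕ S5b): absorbed families, absorption under the dressed gate, dressing
-- sizes, fan-out below one and the amplitude fixed point below A₀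
variable (holder : ∀ (a : P) (K : ℕ), ∀ b b₀, b₀ ∈ (Sabs a K) b → (𝒯.B a K).birthScale b₀ < (𝒯.B a K).birthScale b)
variable (hsub : ∀ (a : P) (K : ℕ), ∀ b, (Sabs a K) b ⊆ (S a K) ((𝒯.B a K).birthScale b) b)
variable (habs : ∀ (a : P) (K : ℕ), (𝒯.T a K).AbsorbsFrom (4 * cδ / r) (fun _ : ℕ => (L ^ 2)⁻¹ * alphaCell κ) (β a K) A (Sabs a K)
  (budgetGate (𝒯.T a K) (s a K) m (S a K) (4 * cδ / r) (fun _ : ℕ => (L ^ 2)⁻¹ * alphaCell κ)))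
variable (hβ : ∀ (a : P) (K : ℕ), ∀ j, j ≤ (𝒯.B a K).K → (β a K) j ≤ β₀ * (L⁻¹ ^ 3) ^ ((𝒯.B a K).K - j))

include W hκ Anch hratio hL hcbar hN₀ hA₀ hm hloc hρ'1 hsmall hr hcδ hsl hFn h𝒢 hB hE hQ hSg hs1 hAsz_birth hAsz_step hlink hδfw
  hDμ hz₁ hpairx hinv hmeas hdefw hrate hne hsup hc0 hcb hreg hs₀ hLb hmult hscale hhoused hvol holder hsub habs hβ

/-! ## §3 END-ALL ∘ suppliers: the row root at every cutoff and run parameter -/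

/-- **END-ALL ∘ SUPPLIERS (ratio face) — THE ROW ROOT `DressedStability 𝒯`** [bookkeeping]: row S3e's END-ALL
`dressedStability_of_ratioSchedules` BY NAME with its four structural per-`(a, K)` binder families supplied BY NAME — F-8 `hlin`
from the booking convention (`hlin_budgetGate_of_lin_le_sSup`), L-C `hS`∕`hcount` from the anchoring data
(`count_of_anchoring_cell`), L-B `hbirth` from the absorption data at the cell's constants (`hbirth_of_absorbsFrom_live_cell`, its
live-family count being the anchored `hcount` itself).  The K-∕μ-∕a-free scalars (`L`, `c̄`, `N₀`, `A₀`, `m`, `s̄⁰`, `ρ′`, `κ`, `r`,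
`c_δ`, `v`, `mB`, `A`, `β₀`) precede `∀ a` and `∀ K` (RULING R-t4r2-Q2 ∕ k1).  NOT «NE1′ proved»: every wall binder is displayed;
0 instantiated on Bałaban's densities. [folklore] -/
theorem dressedStability_of_suppliedSchedules (hvN₀ : (v : ℝ) * mB ≤ N₀) (hA : 0 ≤ A)
    (hfan : fanout A N₀ ρ' < 1) (hamp : absorbAmplitude β₀ A N₀ ρ' ≤ A₀) :
    DressedStability 𝒯 :=
  dressedStability_of_ratioSchedules 𝒯 W hκ hratio hL hcbar hN₀ hA₀ hm hloc hρ'1 hsmall hr hcδ hsl hFn h𝒢 hB hE hQ hSg hs1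
    hAsz_birth hAsz_step hlink hδfw hDμ hz₁ hpairx hinv hmeas hdefw hrate
    (fun a K => hlin_budgetGate_of_lin_le_sSup (T := 𝒯.T a K) (hne a K) (hsup a K))
    hc0 hcb hreg hs₀
    (fun a K => (count_of_anchoring_cell (Anch a K) hLb hL (hmult a K) (hscale a K) (hhoused a K) (hvol a K) hvN₀).1)
    (fun a K => (count_of_anchoring_cell (Anch a K) hLb hL (hmult a K) (hscale a K) (hhoused a K) (hvol a K) hvN₀).2)
    (fun a K =>
      hbirth_of_absorbsFrom_live_cell hL (div_nonneg (mul_nonneg (by norm_num) hcδ) hr.le) hcbar hκ hN₀ hA₀ hm hloc hρ'1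
        hsmall (𝒯.T a K) (fun _ : ℕ => (L ^ 2)⁻¹ * alphaCell κ) (s a K) (S a K) (holder a K) (hsub a K)
        (count_of_anchoring_cell (Anch a K) hLb hL (hmult a K) (hscale a K) (hhoused a K) (hvol a K) hvN₀).2 hA (habs a K)
        (hβ a K) hfan hamp)

/-- **… WITH THE CONSTANTS DISPLAYED** [bookkeeping]: the class at every `(a, K)` is `twoRate A₀ (rhoOne L⁻² (4c_δ∕r) c̄ κ) L⁻³ K`.
[folklore] -/
theorem dressedStabilityWith_of_suppliedSchedules (hvN₀ : (v : ℝ) * mB ≤ N₀) (hA : 0 ≤ A)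
    (hfan : fanout A N₀ ρ' < 1) (hamp : absorbAmplitude β₀ A N₀ ρ' ≤ A₀) :
    DressedStabilityWith 𝒯 A₀ (rhoOne (L ^ 2)⁻¹ (4 * cδ / r) cbar κ) (L⁻¹ ^ 3) :=
  dressedStabilityWith_of_ratioSchedules 𝒯 W hκ hratio hL hcbar hN₀ hA₀ hm hloc hρ'1 hsmall hr hcδ hsl hFn h𝒢 hB hE hQ hSg hs1
    hAsz_birth hAsz_step hlink hδfw hDμ hz₁ hpairx hinv hmeas hdefw hrate
    (fun a K => hlin_budgetGate_of_lin_le_sSup (T := 𝒯.T a K) (hne a K) (hsup a K))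
    hc0 hcb hreg hs₀
    (fun a K => (count_of_anchoring_cell (Anch a K) hLb hL (hmult a K) (hscale a K) (hhoused a K) (hvol a K) hvN₀).1)
    (fun a K => (count_of_anchoring_cell (Anch a K) hLb hL (hmult a K) (hscale a K) (hhoused a K) (hvol a K) hvN₀).2)
    (fun a K =>
      hbirth_of_absorbsFrom_live_cell hL (div_nonneg (mul_nonneg (by norm_num) hcδ) hr.le) hcbar hκ hN₀ hA₀ hm hloc hρ'1
        hsmall (𝒯.T a K) (fun _ : ℕ => (L ^ 2)⁻¹ * alphaCell κ) (s a K) (S a K) (holder a K) (hsub a K)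
        (count_of_anchoring_cell (Anch a K) hLb hL (hmult a K) (hscale a K) (hhoused a K) (hvol a K) hvN₀).2 hA (habs a K)
        (hβ a K) hfan hamp)

/-! ## §4 The ROOT-B hand-off, positional counts read off the anchoring -/

/-- **END-ALL ∘ SUPPLIERS ⟹ ROOT-B `DressedBudget 𝒯 wt`** [bookkeeping]: with nonnegative cube weights bounded by `w̄` and — in
place of row S3e's displayed `hcountB` — the SAME anchoring (per-block multiplicity `mB`, now with a volume bound `1 ≤ v` so that
`mB ≤ v·mB ≤ N₀`), the budget root of record holds: `dressedBudget_of_ratioSchedules` BY NAME with `hcountB` from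
`positionalCount_of_anchoring_cell`. [folklore] -/
theorem dressedBudget_of_suppliedSchedules (hvN₀ : (v : ℝ) * mB ≤ N₀) (hA : 0 ≤ A)
    (hfan : fanout A N₀ ρ' < 1) (hamp : absorbAmplitude β₀ A N₀ ρ' ≤ A₀)
    {wt : P → ℕ → ℕ → ℝ} {wbar : ℝ} (hwbar : 0 ≤ wbar)
    (hw0 : ∀ a K, ∀ j ≤ K, 0 ≤ wt a K j) (hwb : ∀ a K, ∀ j ≤ K, wt a K j ≤ wbar) (hv : 1 ≤ v) :
    DressedBudget 𝒯 wt :=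
  have hmN₀ : (mB : ℝ) ≤ N₀ := by
    have h1 : (1 : ℝ) ≤ (v : ℝ) := by exact_mod_cast hv
    have hmB : (0 : ℝ) ≤ (mB : ℝ) := by positivity
    nlinarith
  dressedBudget_of_ratioSchedules 𝒯 W hκ hratio hL hcbar hN₀ hA₀ hm hloc hρ'1 hsmall hr hcδ hsl hFn h𝒢 hB hE hQ hSg hs1
    hAsz_birth hAsz_step hlink hδfw hDμ hz₁ hpairx hinv hmeas hdefw hrate
    (fun a K => hlin_budgetGate_of_lin_le_sSup (T := 𝒯.T a K) (hne a K) (hsup a K))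
    hc0 hcb hreg hs₀
    (fun a K => (count_of_anchoring_cell (Anch a K) hLb hL (hmult a K) (hscale a K) (hhoused a K) (hvol a K) hvN₀).1)
    (fun a K => (count_of_anchoring_cell (Anch a K) hLb hL (hmult a K) (hscale a K) (hhoused a K) (hvol a K) hvN₀).2)
    (fun a K =>
      hbirth_of_absorbsFrom_live_cell hL (div_nonneg (mul_nonneg (by norm_num) hcδ) hr.le) hcbar hκ hN₀ hA₀ hm hloc hρ'1
        hsmall (𝒯.T a K) (fun _ : ℕ => (L ^ 2)⁻¹ * alphaCell κ) (s a K) (S a K) (holder a K) (hsub a K)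
        (count_of_anchoring_cell (Anch a K) hLb hL (hmult a K) (hscale a K) (hhoused a K) (hvol a K) hvN₀).2 hA (habs a K)
        (hβ a K) hfan hamp)
    hwbar hw0 hwb
    (fun a K => positionalCount_of_anchoring_cell (Anch a K) hLb hL (hmult a K) hmN₀)

end EndAll

end Summit.QuantumFields.BalabanUV.T4Continuum.NE1p.DressedStabilityOfSuppliedSchedules

end
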